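import Summits.QuantumFields.YangMills.Theorems.UnitScaleTiltProp7LandauTransversalityReduction
import Summits.QuantumFields.YangMills.Theorems.UnitScaleTiltProp7ChartRealityKnitS
import Summits.QuantumFields.YangMills.Theorems.UnitScaleTiltProp7QTwSHessianReality
import HarnessLib

/-!
# Route `UnitScaleTilt`, crux K1 child «MinimiserStabilityRegPr» (stmt-QuantumFields-19200), skeleton v10, stub `stub_existenceMinimalOrbit` (EX), route (α) —
# **(P2) «LANDAU TRANSVERSALITY AT THE CHART POINT», THE `𝔰𝔲(2)` TWIN OF THE EXACT REDUCTION** (sibling of ✓`…LandauTransversalityReduction`, same namespace): `hSplitD`'s REAL currency —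
# `δ` `𝔰𝔲(2)`-valued in print's linear slice, `N` Hermitian-traceless — from (P2-core)-𝔰𝔲(2), by the reality of the (47)-chart's derivative and the skew Hilbert half at `U₀`.

Cell `ym3-torus`, width seat `ym3-torus-px10` (gen 0; WIDTH COPY of ym3-torus-p1).  THEOREMS ONLY (0 `def`, 0 `sorry`).  `--supports stmt-QuantumFields-19200 --as helper`,
count-neutral.  YM₃ on T³ is a ladder rung (R3), not the Clay problem; nothing here claims the stub, the crux, d = 4 or the mass gap.  LOCATE memo
`pub/ym3-torus/ym3-torus-px10/LOCATE-P2-LANDAU-px10.md` (19200 evidence #58).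

WHAT IS PROVED (member `F`, `h : n ≤ K`; sorry-free, no definition; ns `…Theorems.Prop7LandauTransversalityReduction`):
* ★`chartDeriv_mapsTo_su2` — the Fréchet derivative `D` of `χ = (A ↦ A − H·Dfix(CmapTwS U₀) H C₂ˢ A)` at an `𝔰𝔲(2)`-valued `A′` (`‖A′‖ < ε`, (D47) window, `H` real) maps `𝔰𝔲(2)`-valued
  fields to `𝔰𝔲(2)`-valued fields: `χ` maps the `𝔰𝔲(2)`-valued `ε`-ball into the closed real subspace of `𝔰𝔲(2)`-valued fields (✓`Prop7ChartRealityKnitS.isHermitian_trace_zero_of_chartS`,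
  ✓`isClosed_skewHermitian_traceless`), so its derivative does (✓`Prop7QTwSHessianReality.fderiv_apply_mem_of_mapsTo_of_ball_at`).
* ★★`exists_su2_kerQTwS_of_sliceTangent` — an `𝔰𝔲(2)`-valued twisted-slice tangent `β` (`fderiv(logChartTwS U₀)(χA′) β = 0`) is `Dδ₀` with `δ₀` `𝔰𝔲(2)`-valued and `QTwS U₀ δ₀ = 0`:
  `D` is onto (✓`chartDeriv_surjective`) hence injective (finite dimension), maps the finite-dimensional real subspace into itself, hence onto it; the `Q(U₀)`-row is STEP 1
  (✓`fderiv_logChartTwS_comp_chartDeriv_eq_QTwS`).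
* ★★★`hSplitP2_su2_of_core` — ✓`hSplitP2_of_core` in `hSplitD`'s currency: from (P2-core)-𝔰𝔲(2) («for every `𝔰𝔲(2)`-valued `l` with `toL2S l ∈ N_S(U₀)` the pushed `U₀`-gauge direction
  `M(D(toL2⁻¹ D_{U₀} toL2S l))` is `M(Dσ′) + Gd N′` with `σ′` `𝔰𝔲(2)`-valued in the linear slice, `N′` Hermitian-traceless») every `𝔰𝔲(2)`-valued `β` with `fderiv(logChartTwS U₀)(χA′) β = 0`
  is `Mβ = M(Dδ) + Gd N`, `δ` `𝔰𝔲(2)`-valued, `QTwS U₀ δ = 0`, `IsLandauPrintS c₀ cB U₀ δ`, `N` Hermitian-traceless (skew Hilbert half ✓`Prop7GaugeSliceDecomposition.exists_slice_add_gaugeDir_skew_pi`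
  at the `QTwS` reality rows ✓`QTwS_star_comm_of_regPr`∕`QTwS_traceless_of_regPr`∕`QTwS_scalar_of_regPr` of `RegPr`).
HONEST SCOPE.  Exact bookkeeping over landed letters; (P2-core)-𝔰𝔲(2) is a HYPOTHESIS (supplier: the Neumann perturbation of [Balaban1985BackgroundPropagators] (3.22) located in the memo, on one
N06(d = 3)-class letter); the 𝔰𝔲(2)-reality of T5-B's `β` is the θ-hand's (★w4-20520 g6); nothing of print is asserted; no stub ∕ crux statement is advanced.

References: T. Bałaban, CMP 102 (1985) 277–309 [Balaban1985Variational] ((45) p.285, (47)–(51) pp.285–286, (82)–(83) p.290, Prop. 3 p.289); CMP 99 (1985) 389–434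
[Balaban1985BackgroundPropagators] ((3.3) p.391, (3.14) p.393, (3.20)–(3.23) p.394, (3.115) p.418); CMP 99 (1985) 75–102 [Balaban1985RegularSpaces] (Sect. D pp.89–95).
-/

set_option autoImplicit false

noncomputable section

open scoped Matrix.Norms.L2Operator Topology Matrix
open Filter Metric

namespace Summit.QuantumFields.YangMills.Theorems.Prop7LandauTransversalityReduction

open Literature.MathematicalPhysics.QuantumFieldTheory.Balaban1983to89
open Literature.MathematicalPhysics.QuantumFieldTheory.Balaban1983to89.T3ContinuumYM3Torus
open Literature.MathematicalPhysics.QuantumFieldTheory.Balaban1983to89.T3PrintedRegularMinimiser (RegPr)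
open Literature.MathematicalPhysics.QuantumFieldTheory.Balaban1983to89.T3SectALandauChart (eta eta_pos)
open B11Prop3Model (Dfix)
open Summit.QuantumFields.YangMills.Theorems.Prop7SymAvgTwSym (logChartTwS QTwS CmapTwS Chart47T3twS QTwS_star_comm_of_regPr QTwS_scalar_of_regPr QTwS_traceless_of_regPr)
open Summit.QuantumFields.YangMills.Theorems.Prop7SectET3HilbertLetters (W₂ toL2 toL2S DL2)
open Summit.QuantumFields.YangMills.Theorems.Prop7SectET3GaugeProjector (NS RSPi DstarPi)
open Summit.QuantumFields.YangMills.Theorems.Prop7SPrint (IsLandauPrintS)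
open Summit.QuantumFields.YangMills.Theorems.Prop7GaugeSliceDecomposition (exists_slice_add_gaugeDir_skew_pi)
open Summit.QuantumFields.YangMills.Theorems.Prop7ChartRealityKnitS (isClosed_skewHermitian_traceless isHermitian_trace_zero_of_chartS)
open Summit.QuantumFields.YangMills.Theorems.Prop7QTwSHessianReality (fderiv_apply_mem_of_mapsTo_of_ball_at)

variable (F : T3Family) {n K : ℕ} (h : n ≤ K)

/-! ## §5 The `𝔰𝔲(2)` twin — `hSplitD`'s real currency -/

/-- ★ **`Dχ(A′)` MAPS `𝔰𝔲(2)`-VALUED FIELDS TO `𝔰𝔲(2)`-VALUED FIELDS** at an `𝔰𝔲(2)`-valued `A′` in the half ball: `χ` maps the `𝔰𝔲(2)`-valued `ε`-ball into the (closed, real) subspace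
of `𝔰𝔲(2)`-valued fields (✓`isHermitian_trace_zero_of_chartS`, `H` real), so its Fréchet derivative at `A′` does (✓`fderiv_apply_mem_of_mapsTo_of_ball_at`).
[cite: Balaban1985Variational, (51) p.286, Prop. 3 p.289; Balaban1985BackgroundPropagators, (3.14) p.393] -/
theorem chartDeriv_mapsTo_su2 [Fact (0 < (F.L : ℝ))] [Fact (0 < ((F.L : ℝ)⁻¹) ^ (K - n))]
    {ε₀ e b ε : ℝ} (hε₀ : 0 < ε₀) (he : 0 < e) (hWe : 10 ^ 9 * (F.L : ℝ) ^ 2 * e ≤ 1) (hWε : 10 ^ 12 * (F.L : ℝ) ^ 3 * ε₀ ≤ 1)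
    (U₀ : GaugeField (F.P K) 0 (Matrix.specialUnitaryGroup (Fin 2) ℂ)) (hreg : RegPr F n K ε₀ U₀)
    {H : (PBond (F.P n) 0 → Matrix (Fin 2) (Fin 2) ℂ) →ₗ[ℂ] (PBond (F.P K) 0 → Matrix (Fin 2) (Fin 2) ℂ)} (hb : 0 ≤ b) (hHop : ∀ Y, ‖H Y‖ ≤ b * ‖Y‖)
    (hHR : ∀ Y : PBond (F.P n) 0 → Matrix (Fin 2) (Fin 2) ℂ, (∀ c, star (Y c) = -Y c ∧ (Y c).trace = 0) → ∀ b', star (H Y b') = -H Y b' ∧ (H Y b').trace = 0)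
    (hq : 9 * (40 * (2 * (3 * (2 * e + 2700 * (F.L : ℝ) * ε₀))) / (e * eta F n K) ^ 2) * b * ε < 1) (hRε : 6 * ε ≤ e * eta F n K)
    {A' : PBond (F.P K) 0 → Matrix (Fin 2) (Fin 2) ℂ} (hA' : ‖A'‖ < ε) (hA'R : ∀ b', star (A' b') = -A' b' ∧ (A' b').trace = 0)
    {D : (PBond (F.P K) 0 → Matrix (Fin 2) (Fin 2) ℂ) →L[ℂ] (PBond (F.P K) 0 → Matrix (Fin 2) (Fin 2) ℂ)}
    (hD : HasFDerivAt (fun A : PBond (F.P K) 0 → Matrix (Fin 2) (Fin 2) ℂ =>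
      A - H (Dfix (CmapTwS F n K h U₀) H (40 * (2 * (3 * (2 * e + 2700 * (F.L : ℝ) * ε₀))) / (e * eta F n K) ^ 2) A)) D A')
    {v : PBond (F.P K) 0 → Matrix (Fin 2) (Fin 2) ℂ} (hv : ∀ b', star (v b') = -v b' ∧ (v b').trace = 0) :
    ∀ b', star (D v b') = -D v b' ∧ (D v b').trace = 0 := by
  -- the real subspace of skew-Hermitian traceless fine fields
  let S : Submodule ℝ (PBond (F.P K) 0 → Matrix (Fin 2) (Fin 2) ℂ) :=
    { carrier := {A | ∀ b', star (A b') = -A b' ∧ (A b').trace = 0}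
      add_mem' := fun {A B} hA hB b' => by
        refine ⟨?_, ?_⟩
        · rw [Pi.add_apply, star_add, (hA b').1, (hB b').1, neg_add]
        · rw [Pi.add_apply, Matrix.trace_add, (hA b').2, (hB b').2, add_zero]
      zero_mem' := fun b' => by simp
      smul_mem' := fun r A hA b' => by
        refine ⟨?_, ?_⟩
        · rw [Pi.smul_apply, star_smul, star_trivial, (hA b').1, smul_neg]
        · rw [Pi.smul_apply, Matrix.trace_smul, (hA b').2, smul_zero] }
  have hSc : IsClosed (S : Set (PBond (F.P K) 0 → Matrix (Fin 2) (Fin 2) ℂ)) := isClosed_skewHermitian_traceless (PBond (F.P K) 0)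
  -- `χ` maps the `𝔰𝔲(2)`-valued `ε`-ball into `S`
  have hmaps : ∀ y ∈ S, ‖y‖ < ε →
      (y - H (Dfix (CmapTwS F n K h U₀) H (40 * (2 * (3 * (2 * e + 2700 * (F.L : ℝ) * ε₀))) / (e * eta F n K) ^ 2) y)) ∈ S := by
    intro y hy hyε b'
    have hX := isHermitian_trace_zero_of_chartS F h hε₀ he hWe hWε U₀ hreg hb hHop hHR hq hRε hyε hy
      (X := fun b' => (-Complex.I) • (y - H (Dfix (CmapTwS F n K h U₀) H (40 * (2 * (3 * (2 * e + 2700 * (F.L : ℝ) * ε₀))) / (e * eta F n K) ^ 2) y)) b')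
      (by funext b'; simp only [smul_smul, mul_neg, Complex.I_mul_I, neg_neg, one_smul])
    obtain ⟨hH, htr⟩ := hX b'
    set z := (y - H (Dfix (CmapTwS F n K h U₀) H (40 * (2 * (3 * (2 * e + 2700 * (F.L : ℝ) * ε₀))) / (e * eta F n K) ^ 2) y)) b' with hz
    refine ⟨?_, ?_⟩
    · -- `((-i)z)ᴴ = (-i)z` ⇒ `i zᴴ = -i z` ⇒ `zᴴ = -z`
      have h1 : ((-Complex.I) • z)ᴴ = (-Complex.I) • z := hH
      rw [Matrix.conjTranspose_smul, star_neg, Complex.star_def, Complex.conj_I, neg_neg] at h1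
      have h2 := congrArg (fun M : Matrix (Fin 2) (Fin 2) ℂ => Complex.I • M) h1
      rw [smul_smul, smul_smul, Complex.I_mul_I, mul_neg, Complex.I_mul_I, neg_neg, one_smul, neg_one_smul] at h2
      rw [Matrix.star_eq_conjTranspose]
      exact neg_eq_iff_eq_neg.mp h2
    · have h3 : (-Complex.I) • z.trace = 0 := by rw [← Matrix.trace_smul]; exact htr
      exact (smul_eq_zero.1 h3).resolve_left (neg_ne_zero.2 Complex.I_ne_zero)
  exact fderiv_apply_mem_of_mapsTo_of_ball_at hD S S hSc (fun b' => hA'R b') hA' hmaps hv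

/-- ★ **AN `𝔰𝔲(2)`-VALUED TWISTED-SLICE TANGENT IS THE CHART VELOCITY OF AN `𝔰𝔲(2)`-VALUED ELEMENT OF `ker Q(U₀)`**: in the (D47) window with `A′` `𝔰𝔲(2)`-valued and `H` real, every
`𝔰𝔲(2)`-valued `β` with `fderiv(log U̿^{twS})(χA′) β = 0` is `β = Dδ₀`, `δ₀` `𝔰𝔲(2)`-valued, `QTwS U₀ δ₀ = 0` (`Dχ(A′)` is injective and maps the finite-dimensional real subspace of
`𝔰𝔲(2)`-valued fields into itself, hence onto it; STEP 1 for the `Q(U₀)`-row). [cite: Balaban1985Variational, (47)–(51) pp.285–286, (82)–(83) p.290] -/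
theorem exists_su2_kerQTwS_of_sliceTangent [Fact (0 < (F.L : ℝ))] [Fact (0 < ((F.L : ℝ)⁻¹) ^ (K - n))]
    {ε₀ e b ε : ℝ} (hε₀ : 0 < ε₀) (he : 0 < e) (hWe : 10 ^ 9 * (F.L : ℝ) ^ 2 * e ≤ 1) (hWε : 10 ^ 12 * (F.L : ℝ) ^ 3 * ε₀ ≤ 1)
    (U₀ : GaugeField (F.P K) 0 (Matrix.specialUnitaryGroup (Fin 2) ℂ)) (hreg : RegPr F n K ε₀ U₀)
    {H : (PBond (F.P n) 0 → Matrix (Fin 2) (Fin 2) ℂ) →ₗ[ℂ] (PBond (F.P K) 0 → Matrix (Fin 2) (Fin 2) ℂ)} (hb : 0 ≤ b) (hHop : ∀ Y, ‖H Y‖ ≤ b * ‖Y‖)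
    (hHR : ∀ Y : PBond (F.P n) 0 → Matrix (Fin 2) (Fin 2) ℂ, (∀ c, star (Y c) = -Y c ∧ (Y c).trace = 0) → ∀ b', star (H Y b') = -H Y b' ∧ (H Y b').trace = 0)
    (hq : 9 * (40 * (2 * (3 * (2 * e + 2700 * (F.L : ℝ) * ε₀))) / (e * eta F n K) ^ 2) * b * ε < 1) (hRε : 6 * ε ≤ e * eta F n K)
    (h47 : Chart47T3twS F n K h (40 * (2 * (3 * (2 * e + 2700 * (F.L : ℝ) * ε₀))) / (e * eta F n K) ^ 2) ε U₀ H) (hQH : ∀ X, QTwS F n K h U₀ (H X) = X)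
    {A' : PBond (F.P K) 0 → Matrix (Fin 2) (Fin 2) ℂ} (hA' : 2 * ‖A'‖ < ε) (hA'R : ∀ b', star (A' b') = -A' b' ∧ (A' b').trace = 0)
    {D : (PBond (F.P K) 0 → Matrix (Fin 2) (Fin 2) ℂ) →L[ℂ] (PBond (F.P K) 0 → Matrix (Fin 2) (Fin 2) ℂ)}
    (hD : HasFDerivAt (fun A : PBond (F.P K) 0 → Matrix (Fin 2) (Fin 2) ℂ =>
      A - H (Dfix (CmapTwS F n K h U₀) H (40 * (2 * (3 * (2 * e + 2700 * (F.L : ℝ) * ε₀))) / (e * eta F n K) ^ 2) A)) D A')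
    (β : PBond (F.P K) 0 → Matrix (Fin 2) (Fin 2) ℂ) (hβR : ∀ b', star (β b') = -β b' ∧ (β b').trace = 0)
    (hβ : fderiv ℂ (logChartTwS F n K h U₀)
      (A' - H (Dfix (CmapTwS F n K h U₀) H (40 * (2 * (3 * (2 * e + 2700 * (F.L : ℝ) * ε₀))) / (e * eta F n K) ^ 2) A')) β = 0) :
    ∃ δ₀ : PBond (F.P K) 0 → Matrix (Fin 2) (Fin 2) ℂ, (∀ b', star (δ₀ b') = -δ₀ b' ∧ (δ₀ b').trace = 0) ∧ QTwS F n K h U₀ δ₀ = 0 ∧ D δ₀ = β := by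
  have hA'1 : ‖A'‖ < ε := by linarith [norm_nonneg A']
  -- the real subspace of skew-Hermitian traceless fine fields, mapped into itself by `D`
  let S : Submodule ℝ (PBond (F.P K) 0 → Matrix (Fin 2) (Fin 2) ℂ) :=
    { carrier := {A | ∀ b', star (A b') = -A b' ∧ (A b').trace = 0}
      add_mem' := fun {A B} hA hB b' => by
        refine ⟨?_, ?_⟩
        · rw [Pi.add_apply, star_add, (hA b').1, (hB b').1, neg_add]
        · rw [Pi.add_apply, Matrix.trace_add, (hA b').2, (hB b').2, add_zero]
      zero_mem' := fun b' => by simp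
      smul_mem' := fun r A hA b' => by
        refine ⟨?_, ?_⟩
        · rw [Pi.smul_apply, star_smul, star_trivial, (hA b').1, smul_neg]
        · rw [Pi.smul_apply, Matrix.trace_smul, (hA b').2, smul_zero] }
  have hDS : ∀ v ∈ S, (D.restrictScalars ℝ : (PBond (F.P K) 0 → Matrix (Fin 2) (Fin 2) ℂ) →ₗ[ℝ] (PBond (F.P K) 0 → Matrix (Fin 2) (Fin 2) ℂ)) v ∈ S :=
    fun v hv => chartDeriv_mapsTo_su2 F h hε₀ he hWe hWε U₀ hreg hb hHop hHR hq hRε hA'1 hA'R hD hv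
  -- `D` is onto (§2), hence injective (finite dimension), hence so is its restriction to `S`, hence that restriction is onto `S`
  have hsurj := chartDeriv_surjective F h hε₀ he hWe hWε U₀ hreg hb hHop hq hRε hA' hD
  have hinj : Function.Injective D := by
    have h1 : Function.Surjective (D : (PBond (F.P K) 0 → Matrix (Fin 2) (Fin 2) ℂ) →ₗ[ℂ] (PBond (F.P K) 0 → Matrix (Fin 2) (Fin 2) ℂ)) := hsurj
    exact LinearMap.injective_iff_surjective.2 h1
  set DS : S →ₗ[ℝ] S := LinearMap.restrict (D.restrictScalars ℝ : (PBond (F.P K) 0 → Matrix (Fin 2) (Fin 2) ℂ) →ₗ[ℝ] (PBond (F.P K) 0 → Matrix (Fin 2) (Fin 2) ℂ)) hDS with hDSdef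
  have hDSinj : Function.Injective DS := by
    intro x y hxy
    apply Subtype.ext
    apply hinj
    have := congrArg (fun z : S => (z : PBond (F.P K) 0 → Matrix (Fin 2) (Fin 2) ℂ)) hxy
    simpa [hDSdef, LinearMap.restrict_apply] using this
  have hDSsurj : Function.Surjective DS := LinearMap.injective_iff_surjective.1 hDSinj
  obtain ⟨δ₀, hδ₀⟩ := hDSsurj ⟨β, hβR⟩
  have hDδ₀ : D (δ₀ : PBond (F.P K) 0 → Matrix (Fin 2) (Fin 2) ℂ) = β := by
    have := congrArg (fun z : S => (z : PBond (F.P K) 0 → Matrix (Fin 2) (Fin 2) ℂ)) hδ₀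
    simpa [hDSdef, LinearMap.restrict_apply] using this
  refine ⟨δ₀, δ₀.2, ?_, hDδ₀⟩
  have hTD := fderiv_logChartTwS_comp_chartDeriv_eq_QTwS F h hε₀ he hWe hWε U₀ hreg h47 hQH hRε hA'1 hD
  have := DFunLike.congr_fun hTD (δ₀ : PBond (F.P K) 0 → Matrix (Fin 2) (Fin 2) ℂ)
  rw [ContinuousLinearMap.comp_apply, hDδ₀] at this
  rw [← this, hβ]

/-- ★★★ **(P2) IN `hSplitD`'s REAL CURRENCY FROM (P2-core)-𝔰𝔲(2).**  Setting of ★★★`hSplitP2_of_core` with `H` real (`hHR`, the knit's displayed reality of the (46) letter) and `A′`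
`𝔰𝔲(2)`-valued (`hA′R`): if for every `𝔰𝔲(2)`-valued gauge parameter `l` of the residual gauge algebra (`toL2S l ∈ N_S(U₀)`) the pushed `U₀`-gauge direction is `M(Dσ′) + Gd N′` with `σ′`
`𝔰𝔲(2)`-valued in the linear slice and `N′` Hermitian-traceless, then every `𝔰𝔲(2)`-valued twisted-slice tangent `β` at `χ(A′)` is `Mβ = M(Dδ) + Gd N` with `δ` `𝔰𝔲(2)`-valued,
`QTwS U₀ δ = 0`, `IsLandauPrintS c₀ cB U₀ δ`, `N` Hermitian-traceless — the `∃ δ … ∃ N …` clause of ✓`Prop7FibreELOfCritSplitD`'s `hSplitD` for `ξ := Mβ + Gd N_{T5}` after T5-B ∘ θ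
(skew Hilbert half ✓`exists_slice_add_gaugeDir_skew_pi` at the `QTwS` reality rows ✓`QTwS_star_comm_of_regPr`∕`QTwS_traceless_of_regPr`∕`QTwS_scalar_of_regPr`).
[cite: Balaban1985Variational, (45) p.285, (47)–(51) pp.285–286, (82)–(83) p.290, Prop. 3 p.289; Balaban1985BackgroundPropagators, (3.3) p.391, (3.20)–(3.23) p.394, (3.115) p.418; Balaban1985RegularSpaces, Sect. D pp.89–95] -/
theorem hSplitP2_su2_of_core [Fact (0 < (F.L : ℝ))] [Fact (0 < ((F.L : ℝ)⁻¹) ^ (K - n))] {c₀ cB : ℝ} [Fact (0 < c₀)] [Fact (0 < cB)]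
    {ε₀ e b ε : ℝ} (hε₀ : 0 < ε₀) (he : 0 < e) (hWe : 10 ^ 9 * (F.L : ℝ) ^ 2 * e ≤ 1) (hWε : 10 ^ 12 * (F.L : ℝ) ^ 3 * ε₀ ≤ 1)
    (U₀ : GaugeField (F.P K) 0 (Matrix.specialUnitaryGroup (Fin 2) ℂ)) (hreg : RegPr F n K ε₀ U₀)
    {H : (PBond (F.P n) 0 → Matrix (Fin 2) (Fin 2) ℂ) →ₗ[ℂ] (PBond (F.P K) 0 → Matrix (Fin 2) (Fin 2) ℂ)} (hb : 0 ≤ b) (hHop : ∀ Y, ‖H Y‖ ≤ b * ‖Y‖)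
    (hHR : ∀ Y : PBond (F.P n) 0 → Matrix (Fin 2) (Fin 2) ℂ, (∀ c, star (Y c) = -Y c ∧ (Y c).trace = 0) → ∀ b', star (H Y b') = -H Y b' ∧ (H Y b').trace = 0)
    (hq : 9 * (40 * (2 * (3 * (2 * e + 2700 * (F.L : ℝ) * ε₀))) / (e * eta F n K) ^ 2) * b * ε < 1) (hRε : 6 * ε ≤ e * eta F n K)
    (h47 : Chart47T3twS F n K h (40 * (2 * (3 * (2 * e + 2700 * (F.L : ℝ) * ε₀))) / (e * eta F n K) ^ 2) ε U₀ H) (hQH : ∀ X, QTwS F n K h U₀ (H X) = X)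
    {A' : PBond (F.P K) 0 → Matrix (Fin 2) (Fin 2) ℂ} (hA' : 2 * ‖A'‖ < ε) (hA'R : ∀ b', star (A' b') = -A' b' ∧ (A' b').trace = 0)
    {D : (PBond (F.P K) 0 → Matrix (Fin 2) (Fin 2) ℂ) →L[ℂ] (PBond (F.P K) 0 → Matrix (Fin 2) (Fin 2) ℂ)}
    (hD : HasFDerivAt (fun A : PBond (F.P K) 0 → Matrix (Fin 2) (Fin 2) ℂ =>
      A - H (Dfix (CmapTwS F n K h U₀) H (40 * (2 * (3 * (2 * e + 2700 * (F.L : ℝ) * ε₀))) / (e * eta F n K) ^ 2) A)) D A')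
    (M : PBond (F.P K) 0 → (Matrix (Fin 2) (Fin 2) ℂ →L[ℂ] Matrix (Fin 2) (Fin 2) ℂ))
    (Gd : (Site (F.P K) 0 → Matrix (Fin 2) (Fin 2) ℂ) → PBond (F.P K) 0 → Matrix (Fin 2) (Fin 2) ℂ)
    (hcore : ∀ l : Site (F.P K) 0 → Matrix (Fin 2) (Fin 2) ℂ, (∀ x, star (l x) = -l x ∧ (l x).trace = 0) → toL2S F K c₀ l ∈ NS F n K h c₀ cB U₀ →
      ∃ σ' : PBond (F.P K) 0 → Matrix (Fin 2) (Fin 2) ℂ, (∀ b', star (σ' b') = -σ' b' ∧ (σ' b').trace = 0) ∧ QTwS F n K h U₀ σ' = 0 ∧ IsLandauPrintS F n K h c₀ cB U₀ σ' ∧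
        ∃ N' : Site (F.P K) 0 → Matrix (Fin 2) (Fin 2) ℂ, (∀ x, (N' x).IsHermitian ∧ (N' x).trace = 0) ∧
          ∀ b, M b (D ((toL2 F K c₀).symm (DL2 F n K c₀ U₀ (toL2S F K c₀ l))) b) = M b (D σ' b) + Gd N' b)
    (β : PBond (F.P K) 0 → Matrix (Fin 2) (Fin 2) ℂ) (hβR : ∀ b', star (β b') = -β b' ∧ (β b').trace = 0)
    (hβ : fderiv ℂ (logChartTwS F n K h U₀)
      (A' - H (Dfix (CmapTwS F n K h U₀) H (40 * (2 * (3 * (2 * e + 2700 * (F.L : ℝ) * ε₀))) / (e * eta F n K) ^ 2) A')) β = 0) :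
    ∃ δ : PBond (F.P K) 0 → Matrix (Fin 2) (Fin 2) ℂ, (∀ b', star (δ b') = -δ b' ∧ (δ b').trace = 0) ∧ QTwS F n K h U₀ δ = 0 ∧ IsLandauPrintS F n K h c₀ cB U₀ δ ∧
      ∃ N : Site (F.P K) 0 → Matrix (Fin 2) (Fin 2) ℂ, (∀ x, (N x).IsHermitian ∧ (N x).trace = 0) ∧ ∀ b, M b (β b) = M b (D δ b) + Gd N b := by
  -- `β = Dδ₀`, `δ₀` 𝔰𝔲(2)-valued with `Q(U₀)δ₀ = 0`
  obtain ⟨δ₀, hδ₀R, hQ₀, hDδ₀⟩ := exists_su2_kerQTwS_of_sliceTangent F h hε₀ he hWe hWε U₀ hreg hb hHop hHR hq hRε h47 hQH hA' hA'R hD β hβR hβ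
  -- skew Hilbert half at `U₀ ∈ 𝔘_k(ε₀)`
  obtain ⟨S, l, hl, hlR, hSR, hQS, hRS, hdec⟩ := exists_slice_add_gaugeDir_skew_pi (h := h) (c₀ := c₀) (cB := cB) U₀
    (QTwS_star_comm_of_regPr F h hε₀ he hWe hWε U₀ hreg) (QTwS_traceless_of_regPr F h hε₀ he hWe hWε U₀ hreg) (QTwS_scalar_of_regPr F h hε₀ hWε U₀ hreg) δ₀ hQ₀ hδ₀R
  -- (P2-core)-𝔰𝔲(2) on the residual gauge parameter
  obtain ⟨σ', hσ'R, hQσ', hLσ', N', hN'R, hN'⟩ := hcore l hlR hl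
  refine ⟨S + σ', fun b' => ⟨?_, ?_⟩, by rw [map_add, hQS, hQσ', add_zero], ?_, N', hN'R, fun b => ?_⟩
  · rw [Pi.add_apply, star_add, (hSR b').1, (hσ'R b').1, neg_add]
  · rw [Pi.add_apply, Matrix.trace_add, (hSR b').2, (hσ'R b').2, add_zero]
  · show RSPi F n K h c₀ cB U₀ (DstarPi F n K c₀ U₀ (S + σ')) = 0
    have hL' : RSPi F n K h c₀ cB U₀ (DstarPi F n K c₀ U₀ σ') = 0 := hLσ'
    rw [map_add, map_add, hRS, hL', add_zero]
  · rw [← hDδ₀, hdec, map_add, map_add, Pi.add_apply, Pi.add_apply, map_add, map_add, hN', add_assoc]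

end Summit.QuantumFields.YangMills.Theorems.Prop7LandauTransversalityReduction

end
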